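import Literature.Computability.Cryptography.ClassBQPRelProofs
import Literature.Computability.Complexity.OracleEmpty
import Literature.Computability.Complexity.PromiseZPPProofs
import HarnessLib

/-!
# Relativized textbook promise classes: `PromiseBQP^A` and `PromiseBPP'^O`

Topic `Literature/Computability/QuantumComplexity`. The tree has the relativized LANGUAGE classes
`BQPRel A = BQP^A` (`Cryptography/ClassBQP.lean`: poly-time uniform Clifford+T families with
XOR-query gates to the language `A`) and `BPPRel O = BPP^O = bp (P^O)` (`Complexity/Oracle.lean`),
and the unrelativized textbook PROMISE classes `PromiseBQP` (`Cryptography/ClassBQP.lean`,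
Watrous 2009, §III.2: gap `(2/3, 1/3)` required on the promise only) and `PromiseBPP'`
(`Complexity/Promise.lean`, Goldreich 2006, Def. 1.2). This file supplies the two missing corners —
the relativized textbook promise classes — in exactly the shape of those four definitions:

* `PromiseBQPRel A = PromiseBQP^A`: promise problems solved with gap `(2/3, 1/3)` ON THE PROMISE by
  some poly-time uniform family of Clifford+T circuits with oracle gates to `A` (`BQPRel` with
  the two-sided condition split along `Q.yes` / `Q.no`; no condition off the promise);
* `PromiseBPP'Rel O = PromiseBPP'^O`: some `L' ∈ P^O` and coin polynomial `p` accept every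
  yes-instance and reject every no-instance with probability `≥ 2/3` over the coins
  (`PromiseBPP'` with `P` replaced by `PRel O`);
* sanity, all proved: trivial promises (`ofLanguage_mem_PromiseBQPRel_iff`,
  `ofLanguage_mem_PromiseBPP'Rel_iff`: on `⟨L, Lᶜ⟩` the classes are `BQP^A`, `BPP^O`), the empty
  oracle (`PromiseBQPRel_zero : PromiseBQP^0 = PromiseBQP`, via the tree's oracle-gate stripping
  `QCircuitFamily.stripOracles`; `PromiseBPP'Rel_empty : PromiseBPP'^∅ = PromiseBPP'`, via the tree
  theorem `PRel_empty_holds`), antitonicity in the promise, and the easy half of the promise lift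
  (`BQPRel_subset_BPPRel_of_promise`: `PromiseBQP^A ⊆ PromiseBPP'^A ⟹ BQP^A ⊆ BPP^A`).

These are the classes in which the relativized status of the PROMISE LIFT
"`BQP ⊆ BPP ⟹ PromiseBQP ⊆ PromiseBPP'`" (Aaronson–Arkhipov 2013, §10, open problems (9)–(10):
"`P = BQP`" versus "`PromiseP = PromiseBQP`"; the quantum analogue of Goldreich's open problem
"does `BPP = P` for decision problems imply it for promise problems?", Goldreich 2011, §6) is
typed; the oracle relative to which the lift FAILS is built in
`Literature/Barriers/QuantumAdvantage/PromiseLiftRelativization.lean`.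

## Design notes

* Literal copies of the shapes of `BQPRel` / `PromiseBQP` / `PromiseBPP'` (same thresholds as real
  numbers, same `uniformProb` coin model, same `boolPair x y` presentation of coins), so that the
  `ofLanguage` and empty-oracle identities are definitional bookkeeping.
* No new machine model: oracle access of the quantum side is the XOR-query gate of
  `QuantumCircuit.lean` (`acceptProbOn A`), of the classical side the transcript model `PRel O`.

## References

* J. Watrous, *Quantum computational complexity*, in: Encyclopedia of Complexity and Systems
  Science (2009), §III.2 (promise problems; `BQP` as a class of promise problems) [Watrous2009].
* O. Goldreich, *On promise problems: a survey*, in: Theoretical Computer Science — Essays in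
  Memory of Shimon Even, LNCS 3895 (2006), Def. 1.2 and §1.2 (promise-`BPP`, gap only on the promise)
  [Goldreich2006].
* O. Goldreich, *In a world of P = BPP*, in: Studies in Complexity and Cryptography, LNCS 6650
  (2011), §6 (open problems) [Goldreich2011].
* S. Aaronson, A. Arkhipov, *The computational complexity of linear optics*, Theory of Computing 9
  (2013), §10, open problems (9)–(10) [AaronsonArkhipov2013].
* E. Bernstein, U. Vazirani, *Quantum complexity theory*, SIAM J. Comput. 26 (1997), §8 (oracle
  quantum machines) [BernsteinVazirani1997].
-/

namespace Literature.Computability.QuantumComplexity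

open _root_.Computability Literature.Computability.Complexity Literature.Computability.Cryptography

/-! ### The two classes -/

/-- **`PromiseBQP^A`**: the promise problems `Q = (Q.yes, Q.no)` for which some poly-time uniform
family of Clifford+T circuits with XOR-query gates to the oracle language `A` accepts every
yes-instance with probability `≥ 2/3` and every no-instance with probability `≤ 1/3` (no condition
off the promise) — the promise version of the tree's `BQPRel A`, exactly as `PromiseBQP` is the
promise version of `BQP`. [cite: Watrous2009, §III.2] -/
def PromiseBQPRel (A : Language Bool) : Set PromiseProblem :=
  {Q | ∃ F : QCircuitFamily cliffordT, F.IsUniform ∧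
    (∀ x ∈ Q.yes, 2 / 3 ≤ F.acceptProbOn A x) ∧ (∀ x ∈ Q.no, F.acceptProbOn A x ≤ 1 / 3)}

/-- **`PromiseBPP'^O`** (textbook promise-`BPP` relative to the oracle `O`): some `L' ∈ P^O` and a
coin polynomial `p` such that on every yes-instance `x` at least `2/3` of the coin strings `y` of
length `p |x|` have `⟨x, y⟩ ∈ L'`, and on every no-instance at least `2/3` have `⟨x, y⟩ ∉ L'`;
nothing is required off the promise — the promise version of the tree's `BPPRel O = bp (P^O)`,
exactly as `PromiseBPP'` is the promise version of `BPP = bp P`.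
[cite: Goldreich2006, Def. 1.2 and §1.2] -/
def PromiseBPP'Rel (O : Oracle) : Set PromiseProblem :=
  {Q | ∃ L' ∈ PRel O, ∃ p : Polynomial ℕ,
    (∀ x ∈ Q.yes, 2 / 3 ≤ uniformProb (p.eval x.length) {y : List Bool | boolPair x y ∈ L'}) ∧
    (∀ x ∈ Q.no, 2 / 3 ≤ uniformProb (p.eval x.length) {y : List Bool | boolPair x y ∉ L'})}

/-! ### Unfolding and monotonicity -/

/-- Unfolding lemma for `PromiseBQPRel`. [cite: Watrous2009, §III.2] -/
theorem mem_PromiseBQPRel_iff {A : Language Bool} {Q : PromiseProblem} :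
    Q ∈ PromiseBQPRel A ↔ ∃ F : QCircuitFamily cliffordT, F.IsUniform ∧
      (∀ x ∈ Q.yes, 2 / 3 ≤ F.acceptProbOn A x) ∧ (∀ x ∈ Q.no, F.acceptProbOn A x ≤ 1 / 3) :=
  Iff.rfl

/-- Unfolding lemma for `PromiseBPP'Rel`. [cite: Goldreich2006, Def. 1.2] -/
theorem mem_PromiseBPP'Rel_iff {O : Oracle} {Q : PromiseProblem} :
    Q ∈ PromiseBPP'Rel O ↔ ∃ L' ∈ PRel O, ∃ p : Polynomial ℕ,
      (∀ x ∈ Q.yes, 2 / 3 ≤ uniformProb (p.eval x.length) {y : List Bool | boolPair x y ∈ L'}) ∧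
      (∀ x ∈ Q.no, 2 / 3 ≤ uniformProb (p.eval x.length) {y : List Bool | boolPair x y ∉ L'}) :=
  Iff.rfl

/-- `PromiseBQP^A` is antitone in the promise: a machine for `Q` solves every special case of `Q`.
[cite: Goldreich2006, §1.1] -/
theorem mem_PromiseBQPRel_of_subset {A : Language Bool} {Q Q' : PromiseProblem}
    (hy : Q'.yes ≤ Q.yes) (hn : Q'.no ≤ Q.no) (hQ : Q ∈ PromiseBQPRel A) : Q' ∈ PromiseBQPRel A := by
  obtain ⟨F, hU, hyes, hno⟩ := hQ
  exact ⟨F, hU, fun x hx => hyes x (hy hx), fun x hx => hno x (hn hx)⟩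

/-- `PromiseBPP'^O` is antitone in the promise. [cite: Goldreich2006, §1.1] -/
theorem mem_PromiseBPP'Rel_of_subset {O : Oracle} {Q Q' : PromiseProblem}
    (hy : Q'.yes ≤ Q.yes) (hn : Q'.no ≤ Q.no) (hQ : Q ∈ PromiseBPP'Rel O) : Q' ∈ PromiseBPP'Rel O := by
  obtain ⟨L', hL', p, hyes, hno⟩ := hQ
  exact ⟨L', hL', p, fun x hx => hyes x (hy hx), fun x hx => hno x (hn hx)⟩

/-! ### Trivial promises: the language classes -/

/-- The "correct verdict" event of a language at an input inside the language. [folklore] -/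
theorem setOf_boolPair_mem_iff_of_mem {L' L : Language Bool} {x : List Bool} (hx : x ∈ L) :
    {y : List Bool | boolPair x y ∈ L' ↔ x ∈ L} = {y | boolPair x y ∈ L'} := by
  ext y; simp [hx]

/-- The "correct verdict" event of a language at an input outside the language. [folklore] -/
theorem setOf_boolPair_mem_iff_of_not_mem {L' L : Language Bool} {x : List Bool} (hx : x ∉ L) :
    {y : List Bool | boolPair x y ∈ L' ↔ x ∈ L} = {y | boolPair x y ∈ L'}ᶜ := by
  ext y; simp [hx]

/-- **On trivial promises `PromiseBQP^A` is `BQP^A`**: `⟨L, Lᶜ⟩ ∈ PromiseBQP^A ↔ L ∈ BQP^A`.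
[cite: Watrous2009, §III.2] -/
theorem ofLanguage_mem_PromiseBQPRel_iff {A L : Language Bool} :
    PromiseProblem.ofLanguage L ∈ PromiseBQPRel A ↔ L ∈ BQPRel A := by
  simp only [PromiseBQPRel, BQPRel, Set.mem_setOf_eq, PromiseProblem.yes_ofLanguage,
    PromiseProblem.no_ofLanguage]
  refine exists_congr fun F => and_congr_right fun _ => ?_
  exact ⟨fun h x => ⟨h.1 x, fun hx => h.2 x hx⟩, fun h => ⟨fun x => (h x).1, fun x hx => (h x).2 hx⟩⟩

/-- **On trivial promises `PromiseBPP'^O` is `BPP^O`**: `⟨L, Lᶜ⟩ ∈ PromiseBPP'^O ↔ L ∈ BPP^O` (on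
`x ∈ L` the event "correct verdict" is "accept", on `x ∉ L` it is "reject").
[cite: Goldreich2006, §1.2 (Def. 2)] -/
theorem ofLanguage_mem_PromiseBPP'Rel_iff {O : Oracle} {L : Language Bool} :
    PromiseProblem.ofLanguage L ∈ PromiseBPP'Rel O ↔ L ∈ BPPRel O := by
  change _ ↔ L ∈ bp (PRel O)
  constructor
  · rintro ⟨L', hL', p, hyes, hno⟩
    refine ⟨L', hL', p, fun x => ?_⟩
    by_cases hx : x ∈ L
    · rw [setOf_boolPair_mem_iff_of_mem hx]; exact hyes x hx
    · rw [setOf_boolPair_mem_iff_of_not_mem hx]; exact hno x hx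
  · rintro ⟨L', hL', p, h⟩
    refine ⟨L', hL', p, fun x hx => ?_, fun x hx => ?_⟩
    · have hx' : x ∈ L := hx
      have := h x; rwa [setOf_boolPair_mem_iff_of_mem hx'] at this
    · have hx' : x ∉ L := hx
      have := h x; rwa [setOf_boolPair_mem_iff_of_not_mem hx'] at this

/-- **The easy half of the promise lift holds at every oracle**: a collapse of the promise classes
gives the collapse of the language classes, `PromiseBQP^A ⊆ PromiseBPP'^A ⟹ BQP^A ⊆ BPP^A` (trivial
promises). The converse — the PROMISE LIFT — fails relative to an oracle
(`Literature/Barriers/QuantumAdvantage/PromiseLiftRelativization.lean`).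
[cite: AaronsonArkhipov2013, §10 (open problems (9)–(10))] -/
theorem BQPRel_subset_BPPRel_of_promise {A : Language Bool}
    (h : PromiseBQPRel A ⊆ PromiseBPP'Rel (Oracle.ofLanguage A)) :
    BQPRel A ⊆ BPPRel (Oracle.ofLanguage A) := fun _ hL =>
  ofLanguage_mem_PromiseBPP'Rel_iff.1 (h (ofLanguage_mem_PromiseBQPRel_iff.2 hL))

/-! ### The empty oracle: the unrelativized classes -/

/-- **`PromiseBQP^0 = PromiseBQP`**: relative to the empty language the oracle gates act as the
identity and are deleted uniformly (the tree's `QCircuitFamily.stripOracles`,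
`IsUniform.stripOracles`, `acceptProbOn_stripOracles`); conversely an oracle-free witness is a
witness. The promise version of the tree theorem `BQPRel_zero_holds : BQP^0 = BQP`.
[cite: BernsteinVazirani1997, §8.3 (oracle QTMs)] -/
theorem PromiseBQPRel_zero : PromiseBQPRel 0 = PromiseBQP := by
  ext Q
  constructor
  · rintro ⟨F, hU, hyes, hno⟩
    refine ⟨F.stripOracles, F.stripOracles_isOracleFree, hU.stripOracles, fun x hx => ?_, fun x hx => ?_⟩
    · rw [QCircuitFamily.acceptProbOn_stripOracles]; exact hyes x hx
    · rw [QCircuitFamily.acceptProbOn_stripOracles]; exact hno x hx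
  · rintro ⟨F, -, hU, hyes, hno⟩
    exact ⟨F, hU, hyes, hno⟩

/-- **`PromiseBPP'^∅ = PromiseBPP'`**, from the tree theorem `PRel_empty_holds : P^∅ = P`.
[cite: BakerGillSolovay1975, §1] -/
theorem PromiseBPP'Rel_empty : PromiseBPP'Rel Oracle.empty = PromiseBPP' := by
  ext Q
  simp only [mem_PromiseBPP'Rel_iff, PromiseBPP', Set.mem_setOf_eq]
  rw [show PRel Oracle.empty = Classes.P from PRel_empty_holds]

end Literature.Computability.QuantumComplexity
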